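import Mathlib
import Literature.Computability.AlgebraicComplexity.HessianAtOrigin
import Summits.ValiantsHypothesis.ValiantsHypothesis.Theorems.GrenetZeonTwoDimCoefficientsTraceChainHessian

/-!
# Crux `GrenetZeon.TwoDimCoefficients` (stmt-ValiantsHypothesis-8062), stub `stub_dualUnipotent`:
# the Hessian profile of the trace chain — a zero with NON-DEGENERATE Hessian

Continuation of `…TraceChainHessian.lean` (the explicit Hessian `hessMat d w` of the translated
trace chain).  Here:

* `transl_traceChain`, `eval_chainPoint_traceChain` — the point `p = (X₀, 1, …, 1)`,
  `X₀ = diag(1, …, 1, 1 − w)`, is a ZERO of `traceChain d w = tr(X₀ X₁ ⋯ X_{d-1})` and translating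
  by it gives the affine chain of the companion file; `isHomogeneous_traceChain` — degree `d`.
* `chain_kernel_aux` — the kernel computation: the equations `Σ_{b ≠ a} κ(a,b) v_b = 0` of
  `hessMat` along one `(i,j)`-string force `v = 0` as soon as the eigenvalue ratio `λ_i/λ_j` is
  not a non-trivial `(d−1)`-th root of unity (`(1 − w)^{d−1} ≠ 1` for `w ≥ 3`);
* `rank_hessMat` — **`rank hessMat = d·w²`** (`d ≥ 2`, `w ≥ 3`);
* `traceChain_hessianProfile` — **the trace chain `tr(X₀ ⋯ X_{d-1})` (`d ≥ 2`, `w ≥ 3`) is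
  homogeneous of degree `d` in `d·w²` variables and has a zero at which its Hessian has full rank
  `d·w²`.**

Consequence for the stub (drawn in `…DualUnipotentProfileBlind.lean`): the unipotent trace model
of width `m = d·w` contains this polynomial, so with `d = n`, `w = √n` it contains, in width
`n^{3/2}`, a homogeneous degree-`n` polynomial in `n²` variables with a zero of Hessian rank `n²`;
`DualUnipotentBound` with `per_n` replaced by a general polynomial of that profile is false, and
the Hessian method of the line caps at `m ≳ n^{3/2}`.  Numerics that suggested the statement
(w = 3, d = 3..8: rank = d·w² in every case; w = 2: rank drops by 2 for odd d, matching the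
root-of-unity condition) are superseded by the proof.

HONEST FRAMING: a statement about a polynomial the model computes, hence about the METHOD;
`DualUnipotentBound` stays open; `VP ≠ VNP` is not moved.

References: T. Mignon, N. Ressayre, Int. Math. Res. Not. 2004:79, Thm. 1.1; J. M. Landsberg,
*Geometry and Complexity Theory* (2017), §6.4.
-/

-- single-conjunct layout `Summits/ValiantsHypothesis/ValiantsHypothesis`: the duplicated namespace
-- component is mandated by the tree.
set_option linter.dupNamespace false

noncomputable section

namespace Summit.ValiantsHypothesis.ValiantsHypothesis.Cruxes.TwoDimCoefficients.DimTwoCases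

namespace TraceChain

open Literature.Computability.AlgebraicComplexity Matrix MvPolynomial

variable {d w : ℕ}

/-! ### The chosen zero `p = (X₀, 1, …, 1)`: translation, vanishing, homogeneity -/

section Point

/-- Prefix products only see the blocks below the length. [folklore] -/
theorem pprod_congr {R : Type} [Semiring R] (B B' : ℕ → Matrix (Fin w) (Fin w) R) (k : ℕ)
    (h : ∀ a < k, B a = B' a) : pprod w B k = pprod w B' k := by
  induction k with
  | zero => rfl
  | succ k ih =>
    rw [pprod_succ, pprod_succ, ih (fun a ha => h a (Nat.lt_succ_of_lt ha)), h k (Nat.lt_succ_self k)]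

/-- The chosen zero of the trace chain: `X_0 ↦ X₀ = diag(1, …, 1, 1 - w)`, `X_a ↦ 1` (`a ≥ 1`).
[folklore] -/
def chainPoint (d w : ℕ) : Var d w → ℂ := fun s => cst w (X0 w) s.1 s.2.1 s.2.2

/-- Translating the generic blocks by the chosen point gives the affine blocks `M_a` (`a < d`).
[folklore] -/
theorem map_transl_blk (a : ℕ) (ha : a < d) :
    (blk d w a).map (transl (chainPoint d w)) = tblk d w (X0 w) a := by
  ext i j
  simp only [blk, tblk, dif_pos ha, Matrix.map_apply, Matrix.of_apply, transl_X, Matrix.add_apply,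
    chainPoint]

/-- **The translate of the trace chain by the chosen point is the trace of the affine chain.**
[folklore] -/
theorem transl_traceChain :
    transl (chainPoint d w) (traceChain d w) = (pprod w (tblk d w (X0 w)) d).trace := by
  rw [traceChain, AddMonoidHom.map_trace (transl (chainPoint d w))]
  congr 1
  have h := pprod_map (transl (chainPoint d w)).toRingHom (blk d w) d
  exact h.trans (pprod_congr _ _ d fun a ha => map_transl_blk a ha)

/-- `tr X₀ = 0`. [folklore] -/
theorem trace_X0 (hw : 1 ≤ w) : (X0 w).trace = 0 := by
  obtain ⟨v, rfl⟩ : ∃ v, w = v + 1 := ⟨w - 1, by omega⟩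
  rw [X0, Matrix.trace_diagonal, Fin.sum_univ_castSucc]
  have h1 : ∀ x : Fin v, lam (v + 1) x.castSucc = 1 := by
    intro x
    unfold lam
    rw [if_neg]
    simp only [Fin.val_castSucc]
    have := x.isLt
    omega
  have h2 : lam (v + 1) (Fin.last v) = 1 - ((v + 1 : ℕ) : ℂ) := by
    unfold lam
    rw [if_pos (by simp)]
  simp only [h1, h2, Finset.sum_const, Finset.card_univ, Fintype.card_fin, nsmul_eq_mul, mul_one]
  push_cast
  ring

/-- **The chosen point is a zero of the trace chain** (`d, w ≥ 1`). [folklore] -/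
theorem eval_chainPoint_traceChain (hd : 1 ≤ d) (hw : 1 ≤ w) :
    eval (chainPoint d w) (traceChain d w) = 0 := by
  rw [← constantCoeff_transl, transl_traceChain,
    AddMonoidHom.map_trace (constantCoeff : MvPolynomial (Var d w) ℂ →+* ℂ),
    map_constantCoeff_pprod, cpp, if_neg (by omega), trace_X0 hw]

/-- The entries of the prefix product `X_0 ⋯ X_{k-1}` are homogeneous of degree `k` (`k ≤ d`).
[folklore] -/
theorem isHomogeneous_pprod_blk (k : ℕ) (hk : k ≤ d) (i j : Fin w) :
    (pprod w (blk d w) k i j).IsHomogeneous k := by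
  induction k generalizing i j with
  | zero =>
    rw [pprod_zero]
    by_cases h : i = j
    · subst h; rw [Matrix.one_apply_eq]; exact isHomogeneous_one _ _
    · rw [Matrix.one_apply_ne h]; exact isHomogeneous_zero _ _ _
  | succ k ih =>
    rw [pprod_succ, Matrix.mul_apply]
    refine IsHomogeneous.sum _ _ _ fun x _ => ?_
    refine (ih (by omega) i x).mul ?_
    rw [blk, dif_pos (by omega : k < d), Matrix.of_apply]
    exact isHomogeneous_X _ _

/-- **The trace chain is homogeneous of degree `d`.** [folklore] -/
theorem isHomogeneous_traceChain : (traceChain d w).IsHomogeneous d := by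
  rw [traceChain, Matrix.trace]
  exact IsHomogeneous.sum _ _ _ fun x _ => isHomogeneous_pprod_blk d le_rfl x x

end Point

/-! ### The explicit Hessian is non-degenerate (`d ≥ 2`, `w ≥ 3`) -/

section Kernel

/-- Entries of `hessMat`, with the Kronecker conditions outermost. [folklore] -/
theorem hessMat_apply' (s t : Var d w) :
    hessMat d w s t =
      if t.2.1 = s.2.2 then (if t.2.2 = s.2.1 then
        (if (s.1 : ℕ) ≠ (t.1 : ℕ) then (if (s.1 : ℕ) < (t.1 : ℕ) then mu w s.1 s.2.1 else mu w t.1 s.2.2)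
          else 0) else 0) else 0 := by
  simp only [hessMat, Matrix.of_apply]
  by_cases h1 : t.2.1 = s.2.2 <;> by_cases h2 : t.2.2 = s.2.1 <;>
    by_cases h3 : (s.1 : ℕ) ≠ (t.1 : ℕ) <;> simp [h1, h2, h3]

/-- The action of `hessMat` on a vector: for `s = (a,i,j)`,
`(H u)_{(a,i,j)} = Σ_{b ≠ a} κ(a,b)·u_{(b,j,i)}` with `κ(a,b) = μ_a(i)` (`a < b`), `μ_b(j)` (`b < a`).
[folklore] -/
theorem hessMat_mulVec_apply (u : Var d w → ℂ) (a : Fin d) (i j : Fin w) :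
    (hessMat d w *ᵥ u) (a, i, j) =
      ∑ b : Fin d, (if (a : ℕ) ≠ (b : ℕ) then (if (a : ℕ) < (b : ℕ) then mu w a i else mu w b j)
        else 0) * u (b, j, i) := by
  simp only [Matrix.mulVec, dotProduct, Fintype.sum_prod_type, hessMat_apply']
  refine Finset.sum_congr rfl fun b _ => ?_
  simp only [ite_mul, zero_mul, Finset.sum_ite_irrel, Finset.sum_const_zero, Finset.sum_ite_eq',
    Finset.mem_univ, if_true]

/-- `(1 - w)^k ≠ 1` for `w ≥ 3`, `k ≥ 1` (the eigenvalue ratio of `X₀` is not a root of unity).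
[folklore] -/
theorem one_sub_pow_ne_one (hw : 3 ≤ w) {k : ℕ} (hk : 1 ≤ k) : (1 - (w : ℂ)) ^ k ≠ 1 := by
  intro h
  have hz : (1 - (w : ℂ)) = ((1 - (w : ℤ) : ℤ) : ℂ) := by push_cast; ring
  rw [hz, ← Int.cast_pow, Int.cast_eq_one] at h
  have habs := congrArg Int.natAbs h
  rw [Int.natAbs_pow, Int.natAbs_one] at habs
  have h1 : (1 - (w : ℤ)).natAbs = w - 1 := by omega
  rw [h1] at habs
  have := Nat.one_lt_pow (by omega : k ≠ 0) (by omega : 1 < w - 1)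
  omega

/-- The eigenvalues `λ_x ∈ {1, 1 - w}` are non-zero (`w ≥ 3`). [folklore] -/
theorem lam_ne_zero (hw : 3 ≤ w) (x : Fin w) : lam w x ≠ 0 := by
  unfold lam
  split_ifs
  · have := one_sub_pow_ne_one hw (le_refl 1)
    rw [pow_one] at this
    intro h
    apply this
    -- `1 - w = 0` is impossible since `(1 - w)^1 ≠ 1`… use injectivity of casts directly
    exfalso
    have h' : (w : ℂ) = 1 := by linear_combination -h
    have : w = 1 := by exact_mod_cast h'
    omega
  · exact one_ne_zero

/-- `λ_x^{k} = λ_y^{k} ⇒ λ_x = λ_y` for `k ≥ 1` (`w ≥ 3`). [folklore] -/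
theorem lam_eq_of_pow_eq (hw : 3 ≤ w) {k : ℕ} (hk : 1 ≤ k) (x y : Fin w)
    (h : lam w x ^ k = lam w y ^ k) : lam w x = lam w y := by
  unfold lam at h ⊢
  by_cases hx : (x : ℕ) + 1 = w <;> by_cases hy : (y : ℕ) + 1 = w <;>
    simp only [hx, hy, if_true, if_false, one_pow] at h ⊢
  · exact absurd h (one_sub_pow_ne_one hw hk)
  · exact absurd h.symm (one_sub_pow_ne_one hw hk)

/-- **The chain recursion has only the trivial solution.**  Abstract form of the kernel
computation: for `μ ≠ 0` with `μ^{d-1} = ν^{d-1} ⇒ μ = ν` and `d ≥ 2`, the `d` equations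
`Σ_{b ≠ a} κ(a,b) v_b = 0` (`κ(a,b) = [a = 0 ? 1 : μ]` for `a < b`, `[b = 0 ? 1 : ν]` for `b < a`)
force `v_b = 0` for all `b < d`. [folklore] -/
theorem chain_kernel_aux (d : ℕ) (hd : 2 ≤ d) (μ ν : ℂ) (hμ : μ ≠ 0)
    (hpow : μ ^ (d - 1) = ν ^ (d - 1) → μ = ν) (v : ℕ → ℂ)
    (hE : ∀ a < d, ∑ b ∈ Finset.range d,
      (if a ≠ b then (if a < b then (if a = 0 then (1 : ℂ) else μ) else (if b = 0 then (1 : ℂ) else ν))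
        else 0) * v b = 0) :
    ∀ b < d, v b = 0 := by
  obtain ⟨e, rfl⟩ : ∃ e, d = e + 2 := ⟨d - 2, by omega⟩
  have hd1 : e + 2 - 1 = e + 1 := by omega
  rw [hd1] at hpow
  set c : ℕ → ℕ → ℂ := fun a b =>
    if a ≠ b then (if a < b then (if a = 0 then (1 : ℂ) else μ) else (if b = 0 then (1 : ℂ) else ν))
      else 0 with hc
  have hE' : ∀ a < e + 2, ∑ b ∈ Finset.range (e + 2), c a b * v b = 0 := hE
  have hc_lt : ∀ a b, a < b → c a b = if a = 0 then 1 else μ := by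
    intro a b h
    simp only [hc]
    rw [if_pos (show a ≠ b by omega), if_pos h]
  have hc_gt : ∀ a b, b < a → c a b = if b = 0 then 1 else ν := by
    intro a b h
    simp only [hc]
    rw [if_pos (show a ≠ b by omega), if_neg (show ¬ a < b by omega)]
  have hc_eq : ∀ a, c a a = 0 := by
    intro a
    simp only [hc]
    rw [if_neg (fun h => h rfl)]
  -- two-point evaluation of a combination of equations
  have two_point : ∀ (f : ℕ → ℂ) (p q : ℕ), p < e + 2 → q < e + 2 → p ≠ q →
      (∀ b < e + 2, b ≠ p → b ≠ q → f b = 0) →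
      ∑ b ∈ Finset.range (e + 2), f b * v b = f p * v p + f q * v q := by
    intro f p q hp hq hpq hf
    rw [Finset.sum_eq_add p q hpq]
    · intro b hb hbpq
      rw [hf b (Finset.mem_range.mp hb) hbpq.1 hbpq.2, zero_mul]
    · intro h; exact absurd (Finset.mem_range.mpr hp) h
    · intro h; exact absurd (Finset.mem_range.mpr hq) h
  -- a combination `Σ (c a b - r c a' b) v_b` vanishes
  have comb : ∀ a a' (r : ℂ), a < e + 2 → a' < e + 2 →
      ∑ b ∈ Finset.range (e + 2), (c a b - r * c a' b) * v b = 0 := by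
    intro a a' r ha ha'
    simp only [sub_mul, mul_assoc, Finset.sum_sub_distrib, ← Finset.mul_sum, hE' a ha, hE' a' ha',
      mul_zero, sub_zero]
  -- Step 1: `ν v_n = μ v_{n+1}` for `1 ≤ n`, `n + 1 < d`
  have step1 : ∀ n, 1 ≤ n → n + 1 < e + 2 → ν * v n = μ * v (n + 1) := by
    intro n hn1 hnd
    have h2 := two_point (fun b => c (n + 1) b - 1 * c n b) n (n + 1) (by omega) hnd (by omega) ?_
    · rw [comb (n + 1) n 1 hnd (by omega), hc_gt _ _ (by omega), hc_eq, hc_eq, hc_lt _ _ (by omega),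
        if_neg (show n ≠ 0 by omega), if_neg (show n ≠ 0 by omega)] at h2
      linear_combination -h2
    · intro b hb hb1 hb2
      rcases Nat.lt_or_gt_of_ne hb1 with hlt | hgt
      · rw [hc_gt _ _ (by omega), hc_gt _ _ hlt]; ring
      · rw [hc_lt _ _ (by omega), hc_lt _ _ (by omega), if_neg (show n + 1 ≠ 0 by omega),
          if_neg (show n ≠ 0 by omega)]; ring
  -- Step 2: `v_0 = μ v_1`
  have step2 : v 0 = μ * v 1 := by
    have h2 := two_point (fun b => c 1 b - μ * c 0 b) 0 1 (by omega) (by omega) (by omega) ?_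
    · rw [comb 1 0 μ (by omega) (by omega), hc_gt _ _ (by omega), hc_eq, hc_eq, hc_lt _ _ (by omega),
        if_pos rfl, if_pos rfl] at h2
      linear_combination -h2
    · intro b hb hb1 hb2
      rw [hc_lt _ _ (by omega), hc_lt _ _ (by omega), if_neg (show (1 : ℕ) ≠ 0 by omega), if_pos rfl]
      ring
  -- Step 3: `v_0 = ν v_{d-1}`
  have step3 : v 0 = ν * v (e + 1) := by
    have h2 := two_point (fun b => c (e + 1) b - ν * c 0 b) 0 (e + 1) (by omega) (by omega) (by omega) ?_
    · rw [comb (e + 1) 0 ν (by omega) (by omega), hc_gt _ _ (by omega), hc_eq, hc_eq,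
        hc_lt _ _ (by omega), if_pos rfl, if_pos rfl] at h2
      linear_combination -h2
    · intro b hb hb1 hb2
      rw [hc_gt _ _ (by omega), hc_lt _ _ (by omega), if_neg (show b ≠ 0 by omega), if_pos rfl]
      ring
  -- Step 4: `Σ_{1 ≤ b < d} v_b = 0`
  have step4 : ∑ b ∈ Finset.range (e + 2), (if b = 0 then 0 else v b) = 0 := by
    have h := hE' 0 (by omega)
    have h' : ∀ b ∈ Finset.range (e + 2), c 0 b * v b = if b = 0 then 0 else v b := by
      intro b _
      by_cases hb : b = 0
      · rw [if_pos hb, hb, hc_eq, zero_mul]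
      · rw [if_neg hb, hc_lt _ _ (by omega), if_pos rfl, one_mul]
    rw [Finset.sum_congr rfl h'] at h
    exact h
  -- conclusion
  suffices h1 : v 1 = 0 by
    -- from `v 1 = 0`: all `v n = 0`
    have hall : ∀ n, 1 ≤ n → n < e + 2 → v n = 0 := by
      intro n hn
      induction n, hn using Nat.le_induction with
      | base => intro; exact h1
      | succ n hn ih =>
        intro hlt
        have := step1 n hn hlt
        rw [ih (by omega), mul_zero] at this
        exact (mul_eq_zero.mp this.symm).resolve_left hμ
    intro b hb
    rcases Nat.eq_zero_or_pos b with rfl | hpos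
    · rw [step2, h1, mul_zero]
    · exact hall b hpos hb
  by_cases hμν : μ = ν
  · -- equal eigenvalues: all `v_n` (`n ≥ 1`) coincide, and their sum vanishes
    have hall : ∀ n, 1 ≤ n → n < e + 2 → v n = v 1 := by
      intro n hn
      induction n, hn using Nat.le_induction with
      | base => intro; rfl
      | succ n hn ih =>
        intro hlt
        have := step1 n hn hlt
        rw [hμν] at this
        rw [← ih (by omega)]
        exact (mul_left_cancel₀ (hμν ▸ hμ) this).symm
    have hsum : ∑ b ∈ Finset.range (e + 2), (if b = 0 then 0 else v b) =
        ∑ b ∈ Finset.range (e + 2), (v 1 - (if b = 0 then v 1 else 0)) := by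
      refine Finset.sum_congr rfl fun b hb => ?_
      by_cases h0 : b = 0
      · simp [h0]
      · rw [if_neg h0, if_neg h0, sub_zero, hall b (by omega) (Finset.mem_range.mp hb)]
    rw [hsum, Finset.sum_sub_distrib, Finset.sum_const, Finset.card_range, Finset.sum_ite_eq',
      if_pos (Finset.mem_range.mpr (by omega)), nsmul_eq_mul] at step4
    have hne : ((e + 2 : ℕ) : ℂ) - 1 ≠ 0 := by
      rw [sub_ne_zero]; exact_mod_cast (show e + 2 ≠ 1 by omega)
    have : (((e + 2 : ℕ) : ℂ) - 1) * v 1 = 0 := by linear_combination step4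
    exact (mul_eq_zero.mp this).resolve_left hne
  · -- distinct eigenvalues: `μ^{n-1} v_n = ν^{n-1} v_1`, and the two expressions for `v_0` clash
    have hne : μ ^ (e + 1) ≠ ν ^ (e + 1) := fun h => hμν (hpow h)
    have hall : ∀ n, 1 ≤ n → n < e + 2 → μ ^ (n - 1) * v n = ν ^ (n - 1) * v 1 := by
      intro n hn
      induction n, hn using Nat.le_induction with
      | base => intro; simp
      | succ n hn ih =>
        intro hlt
        have h := step1 n hn hlt
        have ih' := ih (by omega)
        obtain ⟨k, rfl⟩ : ∃ k, n = k + 1 := ⟨n - 1, by omega⟩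
        simp only [Nat.add_sub_cancel] at ih' ⊢
        calc μ ^ (k + 1) * v (k + 1 + 1) = μ ^ k * (μ * v (k + 1 + 1)) := by ring
          _ = μ ^ k * (ν * v (k + 1)) := by rw [h]
          _ = ν * (μ ^ k * v (k + 1)) := by ring
          _ = ν * (ν ^ k * v 1) := by rw [ih']
          _ = ν ^ (k + 1) * v 1 := by ring
    have hlast := hall (e + 1) (by omega) (by omega)
    simp only [Nat.add_sub_cancel] at hlast
    have key : (μ ^ (e + 1) - ν ^ (e + 1)) * v 1 = 0 := by
      have e1 : μ ^ e * v 0 = μ ^ (e + 1) * v 1 := by rw [step2]; ring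
      have e2 : μ ^ e * v 0 = ν ^ (e + 1) * v 1 := by
        rw [step3, show μ ^ e * (ν * v (e + 1)) = ν * (μ ^ e * v (e + 1)) by ring, hlast]; ring
      linear_combination e1.symm.trans e2
    exact (mul_eq_zero.mp key).resolve_left (sub_ne_zero.mpr hne)

/-- **`hessMat` has trivial kernel** (`d ≥ 2`, `w ≥ 3`). [folklore] -/
theorem hessMat_mulVec_injective_aux (hd : 2 ≤ d) (hw : 3 ≤ w) (u : Var d w → ℂ)
    (hu : hessMat d w *ᵥ u = 0) : u = 0 := by
  funext ⟨b, j, i⟩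
  -- the `(i, j)`-chain of unknowns `v_n = u_{(n, j, i)}`
  set v : ℕ → ℂ := fun n => if h : n < d then u (⟨n, h⟩, j, i) else 0 with hv
  have hres := chain_kernel_aux d hd (lam w i) (lam w j) (lam_ne_zero hw i)
    (lam_eq_of_pow_eq hw (by omega) i j) v ?_
  · have := hres b b.isLt
    simp only [hv, dif_pos b.isLt, Fin.eta] at this
    exact this
  · intro a ha
    have h := congrFun hu (⟨a, ha⟩, i, j)
    rw [Pi.zero_apply, hessMat_mulVec_apply] at h
    rw [← Fin.sum_univ_eq_sum_range (fun n => (if a ≠ n then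
      (if a < n then (if a = 0 then (1 : ℂ) else lam w i) else (if n = 0 then (1 : ℂ) else lam w j))
        else 0) * v n) d]
    refine Eq.trans (Finset.sum_congr rfl fun x _ => ?_) h
    simp only [hv, dif_pos x.isLt, Fin.eta, mu]

/-- **The explicit Hessian is non-degenerate**: `rank hessMat = d·w²` (`d ≥ 2`, `w ≥ 3`). [folklore] -/
theorem rank_hessMat (hd : 2 ≤ d) (hw : 3 ≤ w) :
    (hessMat d w).rank = Fintype.card (Var d w) := by
  apply Matrix.rank_of_isUnit
  rw [← Matrix.mulVec_injective_iff_isUnit]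
  intro u₁ u₂ h
  have : hessMat d w *ᵥ (u₁ - u₂) = 0 := by rw [Matrix.mulVec_sub, h, sub_self]
  exact sub_eq_zero.mp (hessMat_mulVec_injective_aux hd hw _ this)

end Kernel

/-! ### The Hessian profile of the trace chain -/

/-- **The trace chain has the Hessian profile of the permanent.**  For `d ≥ 2` and `w ≥ 3` the
polynomial `tr(X₀ X₁ ⋯ X_{d-1})` of `d` generic `w × w` blocks is homogeneous of degree `d` in its
`d·w²` variables and has a zero (`(diag(1, …, 1, 1 − w), 1, …, 1)`) at which its Hessian is
non-degenerate (rank `d·w²`).  [folklore] -/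
theorem traceChain_hessianProfile (hd : 2 ≤ d) (hw : 3 ≤ w) :
    (traceChain d w).IsHomogeneous d ∧
      ∃ p : Var d w → ℂ, eval p (traceChain d w) = 0 ∧
        (hess0 (transl p (traceChain d w))).rank = d * w ^ 2 := by
  refine ⟨isHomogeneous_traceChain, chainPoint d w,
    eval_chainPoint_traceChain (by omega) (by omega), ?_⟩
  rw [transl_traceChain, hess0_trace_pprod_tblk, rank_hessMat hd hw]
  simp [Fintype.card_prod, Fintype.card_fin, sq]

end TraceChain

end Summit.ValiantsHypothesis.ValiantsHypothesis.Cruxes.TwoDimCoefficients.DimTwoCases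

end
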